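import Summits.ResolutionOfSingularities.ResolutionOfSingularities.Theorems.WeightedInvariantWeightedConstructionPlexComapAdmissible
import Summits.ResolutionOfSingularities.ResolutionOfSingularities.Theorems.WeightedInvariantWeightedConstructionPlexComapResidueField
import Mathlib.AlgebraicGeometry.Morphisms.Finite
import Mathlib.AlgebraicGeometry.Morphisms.FiniteType

/-!
# B2′, ⊇-half, unconditionally: `plex` does not decrease under smooth pull-back at closed singular points

Route `ResolutionOfSingularities/WeightedInvariant`, crux `WeightedConstruction`
(stmt-ResolutionOfSingularities-0571), line `pointwise-lexmax-hull`, stub `stub_plexComap` (B2′ =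
`∀ p prime, ∀ R : LexmaxHullRule p, R.PlexComap`: `R.plex f₁ (X.comap g) y₁ = R.plex f X (g y₁)` for smooth
`g` at closed `y₁` with `X` singular at `g y₁`). [OURS · L1 W4.3]

* `LexmaxHullRule.plex_le_plex_comap` — the `≥`-half of B2′ for EVERY rule: in the regime of the rule
  (perfect ground field of characteristic `p`; `f`, `f₁` smooth separated quasi-compact; `g` smooth
  with `g ≫ f = f₁`), at a closed point `y₁` with `X` singular at `g y₁`,
  `R.plex f X (g y₁) ≤ R.plex f₁ (X.comap g) y₁`.
  Ingredients: `g y₁` is closed (`Scheme.Hom.closePoints_subset_preimage_closedPoints`, Jacobson),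
  so `κ(g y₁)` is formally smooth over `k` (`formallySmooth_residueField_stalk_of_isClosed`), and
  `plex_le_plex_comap_of_smooth` (admissible profiles pull back; `plex` is the greatest one).

What remains of B2′ is the `≤`-half (domination: every profile admissible upstairs is bounded by one
admissible downstairs — `IsGreatest.eq_of_subset_of_forall_exists_le`), the mathematical content.
NOT a statement of the manuscript under review.
-/

noncomputable section

set_option linter.dupNamespace false -- mandated namespace of this single-conjunct summit

open CategoryTheory CategoryTheory.Limits AlgebraicGeometry TopologicalSpace IsLocalRing
open Literature.AlgebraicGeometry.Resolution

namespace Summit.ResolutionOfSingularities.ResolutionOfSingularities.Theorems.PointwiseLexmaxHull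

/-- **B2′ (`PlexComap`), the `≥`-half, for every rule.** At a closed point `y₁` of `Y₁` with `X`
singular at `g y₁` (`g : Y₁ → Y` a smooth `k`-morphism in the regime of the rule):
`R.plex f X (g y₁) ≤ R.plex f₁ (X.comap g) y₁`. [folklore] -/
theorem LexmaxHullRule.plex_le_plex_comap {p : ℕ} (R : LexmaxHullRule p) ⦃k : Type⦄ [Field k]
    [CharP k p] [PerfectField k] ⦃Y Y₁ : Scheme.{0}⦄
    (f : Y ⟶ Spec (.of k)) [Smooth f] [IsSeparated f] [QuasiCompact f]
    (f₁ : Y₁ ⟶ Spec (.of k)) [Smooth f₁] [IsSeparated f₁] [QuasiCompact f₁]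
    (g : Y₁ ⟶ Y) [Smooth g] (hg : g ≫ f = f₁) (X : Y.IdealSheafData) (y₁ : Y₁)
    (hy₁ : IsClosed ({y₁} : Set Y₁)) (hX : XSing X (g y₁)) :
    R.plex f X (g y₁) ≤ R.plex f₁ (X.comap g) y₁ := by
  haveI : JacobsonSpace Y := LocallyOfFiniteType.jacobsonSpace f
  haveI : LocallyOfFiniteType (g ≫ f) := by rw [hg]; infer_instance
  haveI : LocallyOfFiniteType g := locallyOfFiniteType_of_comp g f
  have hgy : IsClosed ({g y₁} : Set Y) := g.closePoints_subset_preimage_closedPoints hy₁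
  exact plex_le_plex_comap_of_smooth R f f₁ g hg X y₁ hy₁ hgy hX
    (formallySmooth_residueField_stalk_of_isClosed f (g y₁) hgy)

end Summit.ResolutionOfSingularities.ResolutionOfSingularities.Theorems.PointwiseLexmaxHull

end
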